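import Literature.Barriers.RiemannHypothesis.EpsteinZetaRealZeroLocated
import Literature.NumberTheory.LFunctions.SiegelZeroClassNumberAllConductors
import HarnessLib

/-!
# One-point nonnegativity exits across the critical segment, kernel: `L(σ, χ) ≥ 0` at ONE real point
# `σ ∈ (½, 1)` for the odd real primitive `χ` mod `d` forces `h(−d) ≫_σ d^{σ/2}`; a class number below
# the bound forces a real zero of `L(s, χ)` in `(σ, 1)`

Topic `Literature/NumberTheory/LFunctions` (namespace `Literature.NumberTheory.LFunctions`, sub-namespace
`RealPointExit`). Everything in this file is PROVED (theorems only; no definition, no named fact, debt 0).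
Cell `parity-realchar` (SIEGEL INSTRUMENT, conditionals column (3)): the family of Direction-II exits
interpolating between the central-value exit (`σ = ½`: `h(−d) ≫ d^{1/4} log d`,
`CentralValueNonnegativityClassNumberBound.lean`) and Hecke's theorem (`σ → 1⁻`: `h(−d) ≫ √d/log d`), and
their Direction-I contrapositives «small class number ⇒ real zero in `(σ, 1)`».

## The statement and the proof

`χ` is the odd real primitive character mod `d > 4` (the Kronecker character of the imaginary quadratic field of
discriminant `−d`), `h = h(−d)`, `y = √d/2`. As in the central-value file, Dirichlet's class decomposition
`ζ(s)L(s, χ) = ½Σ_Q Z_Q(s)` (tree `Literature.Barriers.RiemannHypothesis.riemannZeta_mul_LFunction_eq_half_sum_of_one_lt_re`,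
continued to `ℂ ∖ {1}`) and `Z_Q(σ) = c_d(σ)Λ_{z_Q}(σ)`, `c_d(σ) = π^σ(√d/2)^{−σ}/Γ(σ) > 0`
(`continuation_ofReal_eq`), reduce `L(σ, χ) ≥ 0` (with `ζ(σ) < 0`) to `Σ_Q Re Λ_{z_Q}(σ) ≤ 0`. At a real
point `σ ∈ (½, 1)`:

* every lattice: `Re Λ_z(σ) = Re Λ₀,z(σ) − 1/σ − 1/(1−σ) ≥ −(1/σ + 1/(1−σ))` (non-negative Mellin integrand) —
  `re_thetaΛ_ofReal_ge_neg`;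
* a lattice with `y = Im z ≥ 1` (the principal class, `y = √d/2`): by the constant-term decomposition
  `Λ_z(σ) = 2y^σΛ(2σ) + 2y^{1−σ}Λ(2−2σ) + E_z(σ)` (tree `Λ_eq_constantTerm_add_besselPart`,
  `|E_z| ≤ 48√y e^{−1.4πy} ≤ 48/49`) and the kernel bounds `Λ(u) ≥ −1/u + 1/(u−1)` (`u > 1`),
  `Λ(u) ≥ −1/u − 1/(1−u)` (`0 < u < 1`) (tree `re_completedRiemannZeta_ge_of_one_lt/_lt_one`):
  **`Re Λ_z(σ) ≥ 2y^σ(1/(2σ−1) − 1/(2σ)) − 2y^{1−σ}(1/(2−2σ) + 1/(2σ−1)) − 1`** — `re_thetaΛ_ofReal_ge_of_one_le_im`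
  (as `σ → ½⁺` the right side tends to `2√y(log y − 2) − …`, the bound of the central-value file).

Hence (`bqfClassNumber_ge_of_LFunction_ofReal_nonneg`, `classNumber_ge_of_LFunction_ofReal_nonneg`):

  **`L(σ, χ) ≥ 0`, `½ < σ < 1` ⇒ `h(−d) ≥ 1 + σ(1−σ)·[2y^σ(1/(2σ−1) − 1/(2σ)) − 2y^{1−σ}(1/(2−2σ) + 1/(2σ−1)) − 1]`, `y = √d/2`,**

of size `≍ σ(1−σ)/(2σ−1) · d^{σ/2}`. Special points:

* `σ = ¾` (`classNumber_ge_of_LFunction_threeQuarters_nonneg`): **`h(−d) ≥ 13/16 + ½(√d/2)^{3/4} − (3/2)(√d/2)^{1/4}`**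
  (`≍ 0.3 d^{3/8}`);
* the Hecke point `σ = 1 − 1/log(√d/2)` (`classNumber_ge_of_LFunction_heckePoint_nonneg`, `√d/2 ≥ e⁴`):
  **`h(−d) ≥ √d/(4e log(√d/2)) − 5 ≥ √d/(2e log d) − 5`** — Hecke's `√d/log d` floor from NONNEGATIVITY AT A
  SINGLE POINT `≈ 1 − 2/log d` (Hecke's lemma, tree `Hecke.lOne_ge_eighth_of_noRealZero_near_one`, assumes no
  zero on the whole window `[1 − 1/(4 log q), 1]` and gives `h ≥ √q/(8π log q)`).

Direction I (contrapositives, with the intermediate value theorem — tree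
`DirichletAbel.LFunction_ofReal_re_pos_of_forall_ne_zero` — and `L(1, χ) > 0`):
`exists_realZero_of_classNumber_lt` **a class number below the `σ`-bound forces a real zero `β ∈ (σ, 1)` of
`L(s, χ)`**; `exists_realZero_gt_threeQuarters_of_classNumber_lt` (zero in `(¾, 1)`),
`exists_realZero_near_one_of_classNumber_lt` (`h(−d) < √d/(4e log(√d/2)) − 5` ⇒ zero in
`(1 − 1/log(√d/2), 1)`, i.e. within `≈ 2/log d` of `1` — the exceptional zero of a class-number-deficient
field, located; compare the tree's `RealZeroRepulsion.exists_realZero_of_lOne_lt`: `L(1,χ) < 1/(8 log q)` ⇒ zero in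
`[1 − 1/(4 log q), 1)`).

Why the Epstein route and not partial summation: Pintz/Hecke-type positivity (`Σ(1∗χ)(n)n^{−σ} ≥ 1`) from a
one-point hypothesis `L(σ,χ) ≥ 0` only yields `L(1,χ) ≫ (√d log d)^{−(1−σ)/(σ−½)}`, useless away from `1`;
the class-by-class Chowla–Selberg expansion has exponentially small error in EVERY class, which is what gives
`d^{σ/2}` uniformly on `(½, 1)` (Sarnak–Zaharescu's and Iwaniec's Eisenstein-series method).

LABEL (cell rule): conditionals II (one-point exits) + I-rows (small `h` ⇒ real zero located), kernel, fact-free.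
WHAT THIS IS NOT: no claim about any actual `L(σ, χ)`; even conductors / real quadratic fields not treated;
nothing here bears on parity (H5).

## References (context; nothing is cited as the source of a named fact)

* [IwaniecConversations2006] H. Iwaniec, *Conversations on the exceptional character*, LNM 1891 (2006), §4
  (4.23)–(4.25) (the `σ = ½` case) and §5 (Sarnak–Zaharescu's method: lower bounds from Eisenstein series at
  Heegner points).
* [SarnakZaharescu2002] P. Sarnak, A. Zaharescu, Duke Math. J. 111 (2002), §2 (the same mechanism under
  Hypothesis H).
* [BatemanGrosswald1964] P. T. Bateman, E. Grosswald, Acta Arith. 9 (1964), Theorems 1–3 (constant term,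
  Bessel part, central value of one class).
* [MontgomeryVaughan2007] §10.1 Exercise 25 (theta continuation); §11.2 Theorem 11.4 (Hecke).
-/

noncomputable section

open Complex Filter Topology MeasureTheory Set
open scoped UpperHalfPlane
open Literature.Barriers.RiemannHypothesis
open Literature.Barriers.Parity
open Literature.NumberTheory.Automorphic
open Literature.NumberTheory.QuadraticFields Literature.NumberTheory.QuadraticFields.Quadratic
open Literature.NumberTheory.QuadraticFields.BinaryQuadraticForm (reducedForms mem_reducedForms_iff
  le_of_isReduced discr_apply principalForm principalForm_mem_reducedForms principalForm_fst)
open _root_.NumberField Module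

namespace Literature.NumberTheory.LFunctions

namespace RealPointExit

/-! ### The Epstein side at a real point `σ ∈ (½, 1)` -/

/-- **Every lattice: `Re Λ_z(σ) ≥ −(1/σ + 1/(1−σ))` for `0 < σ < 1`** (`Λ_z = Λ₀,z − 1/s − 1/(1−s)` with
`Re Λ₀,z(σ) = ∫₀^∞ t^{σ−1} Re f̃_z(t) dt ≥ 0`, the theta continuation of Montgomery–Vaughan Exercise 10.1.25 with a
non-negative integrand). [cite: MontgomeryVaughan2007, §10.1 Exercise 25 (d)] -/
theorem re_thetaΛ_ofReal_ge_neg (z : ℍ) {σ : ℝ} (_h0 : 0 < σ) (_h1 : σ < 1) :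
    -(1 / σ + 1 / (1 - σ)) ≤ ((thetaFEPair z).Λ (σ : ℂ)).re := by
  have hΛ0 : 0 ≤ ((thetaFEPair z).Λ₀ (σ : ℂ)).re := by
    rw [re_Λ₀_eq_integral]
    refine setIntegral_nonneg measurableSet_Ioi fun t ht => ?_
    exact mul_nonneg (Real.rpow_nonneg (le_of_lt ht) _) (re_f_modif_nonneg z ht)
  rw [re_Λ_ofReal]
  linarith

/-- `48 √y e^{−(7/5)πy} ≤ 48/49` for `y ≥ 1` (`e^{(7/5)πy} ≥ e^{4y} ≥ 49^y ≥ 49y` and `√y ≤ y`). [folklore] -/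
private theorem besselBound_le {y : ℝ} (hy : 1 ≤ y) :
    48 * Real.sqrt y * Real.exp (-(7 / 5) * Real.pi * y) ≤ 48 / 49 := by
  have hy0 : 0 < y := by linarith
  -- `e^4 > 49`
  have he := Real.exp_one_gt_d9
  have h2 : (7 : ℝ) < Real.exp 2 := by
    rw [show (2 : ℝ) = 1 + 1 by norm_num, Real.exp_add]; nlinarith
  have h4 : (49 : ℝ) < Real.exp 4 := by
    rw [show (4 : ℝ) = 2 + 2 by norm_num, Real.exp_add]; nlinarith [Real.exp_pos 2]
  -- `e^{4y} ≥ 49 y`: `e^{4y} = e^4 · e^{4(y−1)} ≥ 49 (1 + 4(y−1)) ≥ 49 y`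
  have hexp : 49 * y ≤ Real.exp (4 * y) := by
    rw [show 4 * y = 4 + 4 * (y - 1) by ring, Real.exp_add]
    have h1 : 1 + 4 * (y - 1) ≤ Real.exp (4 * (y - 1)) := by
      have := Real.add_one_le_exp (4 * (y - 1)); linarith
    have h49 : 49 * y ≤ 49 * (1 + 4 * (y - 1)) := by nlinarith
    calc 49 * y ≤ 49 * (1 + 4 * (y - 1)) := h49
      _ ≤ Real.exp 4 * Real.exp (4 * (y - 1)) := by
          nlinarith [Real.exp_pos (4 * (y - 1)), Real.exp_pos (4 : ℝ)]
  have hle : Real.exp (-(7 / 5) * Real.pi * y) ≤ Real.exp (-(4 * y)) :=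
    Real.exp_le_exp.2 (by nlinarith [Real.pi_gt_three])
  rw [Real.exp_neg] at hle
  have hsq : Real.sqrt y ≤ y := by rw [Real.sqrt_le_left hy0.le]; nlinarith
  have hE0 := Real.exp_pos (4 * y)
  have hinv : (Real.exp (4 * y))⁻¹ ≤ 1 / (49 * y) := by
    rw [inv_eq_one_div]; exact one_div_le_one_div_of_le (by positivity) hexp
  calc 48 * Real.sqrt y * Real.exp (-(7 / 5) * Real.pi * y)
      ≤ 48 * y * (1 / (49 * y)) := by
        have := Real.exp_pos (-(7 / 5) * Real.pi * y)
        calc 48 * Real.sqrt y * Real.exp (-(7 / 5) * Real.pi * y)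
            ≤ 48 * y * Real.exp (-(7 / 5) * Real.pi * y) := by nlinarith
          _ ≤ 48 * y * (1 / (49 * y)) := mul_le_mul_of_nonneg_left (hle.trans hinv) (by positivity)
    _ = 48 / 49 := by field_simp

/-- **A lattice with `y = Im z ≥ 1`, real point `σ ∈ (½, 1)`:
`Re Λ_z(σ) ≥ 2y^σ(1/(2σ−1) − 1/(2σ)) − 2y^{1−σ}(1/(2−2σ) + 1/(2σ−1)) − 1`.** From the constant-term
decomposition `Λ_z(σ) = 2y^σΛ(2σ) + 2y^{1−σ}Λ(2−2σ) + E_z(σ)` (Bateman–Grosswald Theorem 1 in Mellin form) with the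
kernel bounds `Λ(2σ) ≥ 1/(2σ−1) − 1/(2σ)`, `Λ(2−2σ) ≥ −1/(2−2σ) − 1/(2σ−1)` (`Λ₀ ≥ 0`) and
`|E_z(σ)| ≤ 48√y e^{−1.4πy} ≤ 48/49` (Theorem 2). [cite: BatemanGrosswald1964, Theorem 1 (3)–(5) and Theorem 2 (8)] -/
theorem re_thetaΛ_ofReal_ge_of_one_le_im (z : ℍ) (hy : 1 ≤ z.im) {σ : ℝ} (hσ : 1 / 2 < σ) (hσ1 : σ < 1) :
    2 * z.im ^ σ * (1 / (2 * σ - 1) - 1 / (2 * σ)) -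
        2 * z.im ^ (1 - σ) * (1 / (2 - 2 * σ) + 1 / (2 * σ - 1)) - 1 ≤
      ((thetaFEPair z).Λ (σ : ℂ)).re := by
  set y := z.im with hydef
  have hy0 : 0 < y := by linarith
  have hσ0 : (0 : ℝ) < σ := by linarith
  -- the decomposition at `s = σ`
  have h0 : (σ : ℂ) ≠ 0 := by exact_mod_cast hσ0.ne'
  have h1 : (σ : ℂ) ≠ 1 := by exact_mod_cast hσ1.ne
  have hh : (σ : ℂ) ≠ 1 / 2 := by
    intro h
    have := congrArg Complex.re h
    simp at this
    linarith
  have hdec := Λ_eq_constantTerm_add_besselPart z hy h0 h1 hh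
  have eA : (2 * ((y : ℝ) : ℂ) ^ (σ : ℂ) * completedRiemannZeta (2 * (σ : ℂ))).re =
      2 * y ^ σ * (completedRiemannZeta ((2 * σ : ℝ) : ℂ)).re := by
    rw [show (2 : ℂ) * (σ : ℂ) = ((2 * σ : ℝ) : ℂ) by push_cast; ring, ← Complex.ofReal_cpow hy0.le,
      show (2 : ℂ) * ((y ^ σ : ℝ) : ℂ) = ((2 * y ^ σ : ℝ) : ℂ) by push_cast; ring,
      Complex.re_ofReal_mul]
  have eB : (2 * ((y : ℝ) : ℂ) ^ (1 - (σ : ℂ)) * completedRiemannZeta (2 - 2 * (σ : ℂ))).re =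
      2 * y ^ (1 - σ) * (completedRiemannZeta ((2 - 2 * σ : ℝ) : ℂ)).re := by
    rw [show (2 : ℂ) - 2 * (σ : ℂ) = ((2 - 2 * σ : ℝ) : ℂ) by push_cast; ring,
      show (1 : ℂ) - (σ : ℂ) = ((1 - σ : ℝ) : ℂ) by push_cast; ring, ← Complex.ofReal_cpow hy0.le,
      show (2 : ℂ) * ((y ^ (1 - σ) : ℝ) : ℂ) = ((2 * y ^ (1 - σ) : ℝ) : ℂ) by push_cast; ring,
      Complex.re_ofReal_mul]
  -- bounds for the three terms
  have hpowA : 0 < y ^ σ := Real.rpow_pos_of_pos hy0 σ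
  have hpowB : 0 < y ^ (1 - σ) := Real.rpow_pos_of_pos hy0 _
  have hA : 2 * y ^ σ * (1 / (2 * σ - 1) - 1 / (2 * σ)) ≤
      2 * y ^ σ * (completedRiemannZeta ((2 * σ : ℝ) : ℂ)).re := by
    have hL := re_completedRiemannZeta_ge_of_one_lt (u := 2 * σ) (by linarith)
    have hL' : 1 / (2 * σ - 1) - 1 / (2 * σ) ≤ (completedRiemannZeta ((2 * σ : ℝ) : ℂ)).re := by
      linarith
    exact mul_le_mul_of_nonneg_left hL' (by positivity)
  have hB : -(2 * y ^ (1 - σ) * (1 / (2 - 2 * σ) + 1 / (2 * σ - 1))) ≤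
      2 * y ^ (1 - σ) * (completedRiemannZeta ((2 - 2 * σ : ℝ) : ℂ)).re := by
    have hL := re_completedRiemannZeta_ge_of_lt_one (u := 2 - 2 * σ) (by linarith) (by linarith)
    have hL' : -(1 / (2 - 2 * σ) + 1 / (2 * σ - 1)) ≤ (completedRiemannZeta ((2 - 2 * σ : ℝ) : ℂ)).re := by
      have e : 1 / (1 - (2 - 2 * σ)) = 1 / (2 * σ - 1) := by ring_nf
      linarith
    have := mul_le_mul_of_nonneg_left hL' hpowB.le
    linarith
  have hC : -(48 / 49 : ℝ) ≤ (epsteinBesselPart z σ).re := by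
    have hn := norm_epsteinBesselPart_le z hy (s := (σ : ℂ)) (by simp; linarith) (by simp; linarith)
    have hb := besselBound_le hy
    have habs := Complex.abs_re_le_norm (epsteinBesselPart z σ)
    have := neg_le_of_abs_le (habs.trans (hn.trans hb))
    linarith
  rw [hdec, Complex.add_re, Complex.add_re, eA, eB]
  linarith

/-- The positive factor `c_d(σ) = π^σ(√d/2)^{−σ}/Γ(σ)` at a real point. [folklore] -/
private theorem realFactor_pos' {d : ℕ} (hd : 4 < d) {σ : ℝ} (hσ : 0 < σ) :
    0 < Real.pi ^ σ * (Real.sqrt d / 2) ^ (-σ) / Real.Gamma σ := by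
  have hd0 : (0 : ℝ) < d := by exact_mod_cast (show 0 < d by omega)
  have h1 : 0 < Real.pi ^ σ := Real.rpow_pos_of_pos Real.pi_pos _
  have h2 : 0 < (Real.sqrt d / 2) ^ (-σ) := Real.rpow_pos_of_pos (by positivity) _
  have h3 := Real.Gamma_pos_of_pos hσ
  positivity

/-- **A reduced class at a real point.** For `(a, b, c)` a reduced form of discriminant `−d` (`d > 4`), ANY
continuation `Z` of `ζ_Q` and `0 < σ < 1`: `Z(σ) = c_d(σ)Λ_z(σ)` (`z = (b + i√d)/(2a)`), so
`Re Z(σ) ≥ −c_d(σ)(1/σ + 1/(1−σ))`. [cite: BatemanGrosswald1964, Theorem 1 (3)–(5)] -/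
theorem re_ofReal_ge_of_mem_reducedForms {d : ℕ} (hd : 4 < d) {a b c : ℤ}
    (hQ : (a, b, c) ∈ reducedForms (-(d : ℤ))) {Z : ℂ → ℂ}
    (hZ : IsEpsteinContinuation (a : ℝ) (b : ℝ) (c : ℝ) Z) {σ : ℝ} (hσ0 : 0 < σ) (hσ1 : σ < 1) :
    -((Real.pi ^ σ * (Real.sqrt d / 2) ^ (-σ) / Real.Gamma σ) * (1 / σ + 1 / (1 - σ))) ≤
      (Z σ).re := by
  have hD0 : (-(d : ℤ)) < 0 := by omega
  obtain ⟨hdisc, ha, -, -⟩ := (mem_reducedForms_iff hD0).1 hQ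
  simp only at ha
  rw [discr_apply] at hdisc
  have hdR : (4 : ℝ) * c * a - (b : ℝ) ^ 2 = d := by
    exact_mod_cast (by linarith : 4 * c * a - b ^ 2 = (d : ℤ))
  have hd4R : (4 : ℝ) < d := by exact_mod_cast hd
  have hpos : IsPosDefForm (a : ℝ) (b : ℝ) (c : ℝ) := ⟨by exact_mod_cast ha, by linarith⟩
  obtain ⟨z, hre, him, -⟩ := exists_zQ' hpos
  have hZ' : IsEpsteinContinuation (c : ℝ) (b : ℝ) (a : ℝ) Z :=
    (isEpsteinContinuation_swap_iff (a : ℝ) (b : ℝ) (c : ℝ) Z).2 hZ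
  rw [continuation_ofReal_eq hpos.swap z hre him hZ' hσ0 hσ1, Complex.re_ofReal_mul, hdR]
  have hF := realFactor_pos' hd hσ0
  have hΛ := re_thetaΛ_ofReal_ge_neg z hσ0 hσ1
  have := mul_le_mul_of_nonneg_left hΛ hF.le
  linarith

/-- **The principal class at a real point `σ ∈ (½, 1)`.** For the reduced form `(1, b, c)` of discriminant `−d`
(`d > 4`; `Im z = √d/2 = y ≥ 1`):
`Re Z(σ) ≥ c_d(σ)·[2y^σ(1/(2σ−1) − 1/(2σ)) − 2y^{1−σ}(1/(2−2σ) + 1/(2σ−1)) − 1]`.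
[cite: BatemanGrosswald1964, Theorem 1 (3)–(5) and Theorem 2 (8)] -/
theorem re_ofReal_ge_of_mem_reducedForms_principal {d : ℕ} (hd : 4 < d) {b c : ℤ}
    (hQ : ((1 : ℤ), b, c) ∈ reducedForms (-(d : ℤ))) {Z : ℂ → ℂ}
    (hZ : IsEpsteinContinuation ((1 : ℤ) : ℝ) (b : ℝ) (c : ℝ) Z) {σ : ℝ} (hσ : 1 / 2 < σ) (hσ1 : σ < 1) :
    (Real.pi ^ σ * (Real.sqrt d / 2) ^ (-σ) / Real.Gamma σ) *
        (2 * (Real.sqrt d / 2) ^ σ * (1 / (2 * σ - 1) - 1 / (2 * σ)) -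
          2 * (Real.sqrt d / 2) ^ (1 - σ) * (1 / (2 - 2 * σ) + 1 / (2 * σ - 1)) - 1) ≤ (Z σ).re := by
  have hD0 : (-(d : ℤ)) < 0 := by omega
  obtain ⟨hdisc, -, -, -⟩ := (mem_reducedForms_iff hD0).1 hQ
  rw [discr_apply] at hdisc
  have hdR : (4 : ℝ) * c * (1 : ℤ) - (b : ℝ) ^ 2 = d := by
    exact_mod_cast (by linarith : 4 * c * 1 - b ^ 2 = (d : ℤ))
  have hd4R : (4 : ℝ) < d := by exact_mod_cast hd
  have hpos : IsPosDefForm ((1 : ℤ) : ℝ) (b : ℝ) (c : ℝ) :=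
    ⟨by exact_mod_cast one_pos, by push_cast at hdR ⊢; linarith⟩
  obtain ⟨z, hre, him, -⟩ := exists_zQ' hpos
  have hZ' : IsEpsteinContinuation (c : ℝ) (b : ℝ) ((1 : ℤ) : ℝ) Z :=
    (isEpsteinContinuation_swap_iff ((1 : ℤ) : ℝ) (b : ℝ) (c : ℝ) Z).2 hZ
  have hσ0 : (0 : ℝ) < σ := by linarith
  rw [continuation_ofReal_eq hpos.swap z hre him hZ' hσ0 hσ1, Complex.re_ofReal_mul, hdR]
  have hF := realFactor_pos' hd hσ0
  have hy : z.im = Real.sqrt d / 2 := by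
    rw [him, hdR]; push_cast; ring
  have hsd : 2 ≤ Real.sqrt d := (Real.le_sqrt' two_pos).2 (by linarith)
  have hy1 : 1 ≤ z.im := by rw [hy]; linarith
  have hΛ := re_thetaΛ_ofReal_ge_of_one_le_im z hy1 hσ hσ1
  rw [hy] at hΛ
  exact mul_le_mul_of_nonneg_left hΛ hF.le

/-! ### The class number bound from `L(σ, χ) ≥ 0` at one point -/

/-- **`L(σ, χ) ≥ 0` at one real point `σ ∈ (½, 1)` ⇒
`h(−d) ≥ 1 + σ(1−σ)[2y^σ(1/(2σ−1) − 1/(2σ)) − 2y^{1−σ}(1/(2−2σ) + 1/(2σ−1)) − 1]`, `y = √d/2`** (form side),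
for the odd real primitive character `χ` mod `d > 4`. Proof: `ζ(σ)L(σ,χ) = ½Σ_Q Z_Q(σ) ≤ 0` (`ζ(σ) < 0`);
the principal term is at least `c_d(σ)·[…]`, each of the other `h − 1` terms at least `−c_d(σ)/(σ(1−σ))`.
This is the Eisenstein-series mechanism of Sarnak–Zaharescu / Iwaniec §5, run at a single real point with
explicit constants. [cite: IwaniecConversations2006, §4 (4.23)–(4.25) and §5] -/
theorem bqfClassNumber_ge_of_LFunction_ofReal_nonneg {d : ℕ} [NeZero d] (hd : 4 < d)
    {χ : DirichletCharacter ℂ d} (hprim : χ.IsPrimitive) (hquad : χ.IsQuadratic) (hodd : χ.Odd)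
    {σ : ℝ} (hσ : 1 / 2 < σ) (hσ1 : σ < 1) (hL : 0 ≤ (χ.LFunction σ).re) :
    1 + σ * (1 - σ) * (2 * (Real.sqrt d / 2) ^ σ * (1 / (2 * σ - 1) - 1 / (2 * σ)) -
        2 * (Real.sqrt d / 2) ^ (1 - σ) * (1 / (2 - 2 * σ) + 1 / (2 * σ - 1)) - 1) ≤
      (BinaryQuadraticForm.classNumber (-(d : ℤ)) : ℝ) := by
  classical
  have hd4R : (4 : ℝ) < d := by exact_mod_cast hd
  have hD0 : (-(d : ℤ)) < 0 := by omega
  have hσ0 : (0 : ℝ) < σ := by linarith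
  have hχ1 : χ ≠ 1 := by
    intro h
    have h1 : χ (-1) = -1 := hodd
    rw [h, MulChar.one_apply (isUnit_one.neg)] at h1
    norm_num at h1
  set S := reducedForms (-(d : ℤ)) with hS
  -- continuations of the class zeta functions
  have hex : ∀ Q : ℤ × ℤ × ℤ, ∃ Z : ℂ → ℂ,
      Q ∈ S → IsEpsteinContinuation (Q.1 : ℝ) (Q.2.1 : ℝ) (Q.2.2 : ℝ) Z := by
    intro Q
    by_cases hQ : Q ∈ S
    · obtain ⟨hdisc, ha, -, -⟩ := (mem_reducedForms_iff hD0).1 hQ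
      rw [show Q = (Q.1, Q.2.1, Q.2.2) from rfl, discr_apply] at hdisc
      have hpos : IsPosDefForm (Q.1 : ℝ) (Q.2.1 : ℝ) (Q.2.2 : ℝ) := by
        refine ⟨by exact_mod_cast ha, ?_⟩
        have : (Q.2.1 : ℝ) ^ 2 - 4 * (Q.1 : ℝ) * (Q.2.2 : ℝ) = ((-(d : ℤ) : ℤ) : ℝ) := by
          exact_mod_cast hdisc
        rw [this]; push_cast; linarith
      obtain ⟨Z, hZ, -⟩ := MontgomeryVaughan2007_epsteinContinuation_holds _ _ _ hpos
      exact ⟨Z, fun _ => hZ⟩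
    · exact ⟨0, fun h => absurd h hQ⟩
  choose Z hZ using hex
  set G : ℂ → ℂ := fun s => 1 / 2 * ∑ Q ∈ S, Z Q s with hGdef
  set F : ℂ → ℂ := fun s => riemannZeta s * χ.LFunction s with hFdef
  -- both sides are analytic on `ℂ ∖ {1}` and agree on `Re s > 1`
  have hU : IsOpen {s : ℂ | s ≠ 1} := isOpen_ne
  have hFd : DifferentiableOn ℂ F {s : ℂ | s ≠ 1} := fun s hs =>
    ((differentiableAt_riemannZeta hs).mul
      ((DirichletCharacter.differentiable_LFunction hχ1) s)).differentiableWithinAt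
  have hGd : DifferentiableOn ℂ G {s : ℂ | s ≠ 1} :=
    (differentiableOn_const _).mul (DifferentiableOn.fun_sum fun Q hQ => (hZ Q hQ).1)
  have hFG : EqOn F G {s : ℂ | s ≠ 1} := by
    refine (hFd.analyticOnNhd hU).eqOn_of_preconnected_of_eventuallyEq (hGd.analyticOnNhd hU)
      isPreconnected_compl_one (show (2 : ℂ) ∈ {s : ℂ | s ≠ 1} by norm_num) ?_
    have hopen : IsOpen {s : ℂ | 1 < s.re} := isOpen_lt continuous_const Complex.continuous_re
    filter_upwards [hopen.mem_nhds (show (2 : ℂ) ∈ {s : ℂ | 1 < s.re} by simp)] with s hs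
    have hs' : 1 < s.re := hs
    simp only [hFdef, hGdef]
    rw [riemannZeta_mul_LFunction_eq_half_sum_of_one_lt_re hd hprim hquad hodd hs']
    congr 1
    exact Finset.sum_congr rfl fun Q hQ => ((hZ Q hQ).2 s hs').symm
  -- at the real point `σ`
  have hσU : ((σ : ℂ)) ∈ {s : ℂ | s ≠ 1} := by
    simp only [Set.mem_setOf_eq]
    exact_mod_cast hσ1.ne
  have heq := hFG hσU
  simp only [hFdef, hGdef] at heq
  -- the left side is `≤ 0`
  have hLHS : (riemannZeta σ * χ.LFunction σ).re ≤ 0 := by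
    rw [Complex.mul_re, riemannZeta_im_eq_zero_of_pos hσ0 hσ1.ne, zero_mul, sub_zero]
    exact mul_nonpos_of_nonpos_of_nonneg (riemannZeta_re_neg_of_pos_of_lt_one hσ0 hσ1).le hL
  rw [heq] at hLHS
  -- the right side, class by class
  set κ : ℝ := Real.pi ^ σ * (Real.sqrt d / 2) ^ (-σ) / Real.Gamma σ with hκ
  have hκ0 : 0 < κ := realFactor_pos' hd hσ0
  set y : ℝ := Real.sqrt d / 2 with hy
  set B : ℝ := 2 * y ^ σ * (1 / (2 * σ - 1) - 1 / (2 * σ)) -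
    2 * y ^ (1 - σ) * (1 / (2 - 2 * σ) + 1 / (2 * σ - 1)) - 1 with hBdef
  set m : ℝ := 1 / σ + 1 / (1 - σ) with hmdef
  -- the principal form is a reduced form with first coefficient `1`
  have h4 : (-(d : ℤ)) % 4 = 0 ∨ (-(d : ℤ)) % 4 = 1 := by
    obtain ⟨K, _i1, _i2, h2, hdisc⟩ := exists_quadraticField_of_odd_primitive hprim hquad hodd
    obtain ⟨bK, hbK⟩ := exists_basis_zero_eq_one h2
    have hD := discr_eq_sq_add_four_mul bK hbK
    rw [hdisc] at hD
    set t : ℤ := bK.repr (bK 1 * bK 1) 1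
    set m : ℤ := bK.repr (bK 1 * bK 1) 0
    rw [hD]
    obtain ⟨k, hk | hk⟩ := Int.even_or_odd' t
    · left
      rw [hk, show (2 * k) ^ 2 + 4 * m = 4 * (k ^ 2 + m) by ring]
      exact Int.mul_emod_right _ _
    · right
      rw [hk, show (2 * k + 1) ^ 2 + 4 * m = 1 + 4 * (k ^ 2 + k + m) by ring, Int.add_mul_emod_self_left]
      norm_num
  set P : ℤ × ℤ × ℤ := principalForm (-(d : ℤ)) with hP
  have hPS : P ∈ S := principalForm_mem_reducedForms hD0 h4
  have hP1 : P.1 = 1 := principalForm_fst _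
  -- lower bounds for the terms
  have hterm : ∀ Q ∈ S, -(κ * m) ≤ (Z Q σ).re := fun Q hQ =>
    re_ofReal_ge_of_mem_reducedForms hd (a := Q.1) (b := Q.2.1) (c := Q.2.2) hQ (hZ Q hQ) hσ0 hσ1
  have hmain : κ * B ≤ (Z P σ).re := by
    have hQ' : ((1 : ℤ), P.2.1, P.2.2) ∈ S := by
      have : P = (P.1, P.2.1, P.2.2) := rfl
      rw [this, hP1] at hPS
      exact hPS
    have hZP := hZ P hPS
    rw [hP1] at hZP
    exact re_ofReal_ge_of_mem_reducedForms_principal hd hQ' hZP hσ hσ1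
  -- summing
  have hcard : S.card = BinaryQuadraticForm.classNumber (-(d : ℤ)) := rfl
  have h1S : 1 ≤ S.card := Finset.card_pos.2 ⟨P, hPS⟩
  have hsum : κ * B + ((S.card : ℝ) - 1) * (-(κ * m)) ≤ ∑ Q ∈ S, (Z Q σ).re := by
    rw [← Finset.add_sum_erase S (fun Q => (Z Q σ).re) hPS]
    refine add_le_add hmain ?_
    have hle : ∑ _Q ∈ S.erase P, (-(κ * m)) ≤ ∑ Q ∈ S.erase P, (Z Q σ).re :=
      Finset.sum_le_sum fun Q hQ => hterm Q (Finset.mem_of_mem_erase hQ)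
    rw [Finset.sum_const, nsmul_eq_mul, Finset.card_erase_of_mem hPS, Nat.cast_sub h1S,
      Nat.cast_one] at hle
    exact hle
  have hre : (1 / 2 * ∑ Q ∈ S, Z Q σ).re = 1 / 2 * ∑ Q ∈ S, (Z Q σ).re := by
    rw [show (1 : ℂ) / 2 = ((1 / 2 : ℝ) : ℂ) by push_cast; ring, Complex.re_ofReal_mul, Complex.re_sum]
  rw [hre] at hLHS
  -- conclude: `κ (B − m (h−1)) ≤ 0`, `κ > 0`, `m = 1/(σ(1−σ))`
  rw [← hcard]
  have hkey' : B - m * ((S.card : ℝ) - 1) ≤ 0 := by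
    by_contra hcon
    push Not at hcon
    have := mul_pos hκ0 hcon
    nlinarith
  have h1σ : (1 : ℝ) - σ ≠ 0 := (by linarith : (0 : ℝ) < 1 - σ).ne'
  have hσne : σ ≠ 0 := hσ0.ne'
  have hmσ : σ * (1 - σ) * m = 1 := by
    rw [hmdef]; field_simp; ring
  have hσσ : 0 < σ * (1 - σ) := mul_pos hσ0 (by linarith)
  have : σ * (1 - σ) * B ≤ (S.card : ℝ) - 1 := by
    have h' := mul_le_mul_of_nonneg_left hkey' hσσ.le
    rw [mul_zero, show σ * (1 - σ) * (B - m * ((S.card : ℝ) - 1)) =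
      σ * (1 - σ) * B - (σ * (1 - σ) * m) * ((S.card : ℝ) - 1) by ring, hmσ, one_mul] at h'
    linarith
  linarith

variable {K : Type*} [Field K] [NumberField K]

/-- **`L(σ, χ) ≥ 0` at one real point `σ ∈ (½, 1)` ⇒
`h_K ≥ 1 + σ(1−σ)[2y^σ(1/(2σ−1) − 1/(2σ)) − 2y^{1−σ}(1/(2−2σ) + 1/(2σ−1)) − 1]`, `y = √d/2`** (field side), for
every imaginary quadratic field `K` with `d_K = −d`, `d > 4`, `χ` the odd real primitive character mod `d`.
[cite: IwaniecConversations2006, §4 (4.23)–(4.25) and §5] -/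
theorem classNumber_ge_of_LFunction_ofReal_nonneg (h2 : finrank ℚ K = 2) {d : ℕ} [NeZero d]
    (hdK : NumberField.discr K = -(d : ℤ)) (hd : 4 < d) {χ : DirichletCharacter ℂ d}
    (hprim : χ.IsPrimitive) (hquad : χ.IsQuadratic) (hodd : χ.Odd)
    {σ : ℝ} (hσ : 1 / 2 < σ) (hσ1 : σ < 1) (hL : 0 ≤ (χ.LFunction σ).re) :
    1 + σ * (1 - σ) * (2 * (Real.sqrt d / 2) ^ σ * (1 / (2 * σ - 1) - 1 / (2 * σ)) -
        2 * (Real.sqrt d / 2) ^ (1 - σ) * (1 / (2 - 2 * σ) + 1 / (2 * σ - 1)) - 1) ≤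
      (classNumber K : ℝ) := by
  have hdneg : NumberField.discr K < 0 := by rw [hdK]; omega
  have hh := card_reducedForms_eq_classNumber h2 hdneg
  rw [hdK] at hh
  have := bqfClassNumber_ge_of_LFunction_ofReal_nonneg hd hprim hquad hodd hσ hσ1 hL
  rw [hh] at this
  exact this

/-- **`σ = ¾`: `L(¾, χ) ≥ 0 ⇒ h_K ≥ 13/16 + ½(√d/2)^{3/4} − (3/2)(√d/2)^{1/4}`** (`≍ 0.3·d^{3/8}`).
[cite: IwaniecConversations2006, §4 (4.23)–(4.25) and §5] -/
theorem classNumber_ge_of_LFunction_threeQuarters_nonneg (h2 : finrank ℚ K = 2) {d : ℕ} [NeZero d]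
    (hdK : NumberField.discr K = -(d : ℤ)) (hd : 4 < d) {χ : DirichletCharacter ℂ d}
    (hprim : χ.IsPrimitive) (hquad : χ.IsQuadratic) (hodd : χ.Odd)
    (hL : 0 ≤ (χ.LFunction (3 / 4)).re) :
    13 / 16 + (Real.sqrt d / 2) ^ (3 / 4 : ℝ) / 2 - 3 / 2 * (Real.sqrt d / 2) ^ (1 / 4 : ℝ) ≤
      (classNumber K : ℝ) := by
  have h34 : ((3 / 4 : ℝ) : ℂ) = 3 / 4 := by push_cast; ring
  rw [← h34] at hL
  have h := classNumber_ge_of_LFunction_ofReal_nonneg h2 hdK hd hprim hquad hodd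
    (σ := 3 / 4) (by norm_num) (by norm_num) hL
  have e1 : (1 : ℝ) - 3 / 4 = 1 / 4 := by norm_num
  rw [e1] at h
  norm_num at h ⊢
  linarith

/-! ### The Hecke point `σ = 1 − 1/log y` -/

set_option maxHeartbeats 400000 in
/-- Numerics at the Hecke point: for `L = log y ≥ 4` and `σ = 1 − 1/L`,
`σ(1−σ)[2(y/e)(1/(2σ−1) − 1/(2σ)) − 2e(1/(2−2σ) + 1/(2σ−1)) − 1] ≥ y/(2eL) − 6`. [folklore] -/
private theorem heckePoint_bound {y : ℝ} (hy : Real.exp 4 ≤ y) :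
    y / (2 * Real.exp 1 * Real.log y) - 6 ≤
      (1 - 1 / Real.log y) * (1 - (1 - 1 / Real.log y)) *
        (2 * y ^ (1 - 1 / Real.log y) * (1 / (2 * (1 - 1 / Real.log y) - 1) - 1 / (2 * (1 - 1 / Real.log y))) -
          2 * y ^ (1 - (1 - 1 / Real.log y)) *
            (1 / (2 - 2 * (1 - 1 / Real.log y)) + 1 / (2 * (1 - 1 / Real.log y) - 1)) - 1) := by
  have he4 : 0 < Real.exp 4 := Real.exp_pos 4
  have hy0 : 0 < y := lt_of_lt_of_le he4 hy
  set L := Real.log y with hLdef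
  have hL4 : 4 ≤ L := by
    rw [hLdef, Real.le_log_iff_exp_le hy0]; exact hy
  have hL0 : 0 < L := by linarith
  -- `y^{1/L} = e`, `y^{1 − 1/L} = y/e`
  have hpow1 : y ^ (1 / L) = Real.exp 1 := by
    rw [Real.rpow_def_of_pos hy0, ← hLdef]
    congr 1
    field_simp
  have hpow2 : y ^ (1 - 1 / L) = y / Real.exp 1 := by
    rw [Real.rpow_sub hy0, Real.rpow_one, hpow1]
  have e1 : (1 : ℝ) - (1 - 1 / L) = 1 / L := by ring
  rw [e1, hpow1, hpow2]
  have he := Real.exp_one_gt_d9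
  have he' := Real.exp_one_lt_d9
  set e := Real.exp 1 with hedef
  have he0 : 0 < e := Real.exp_pos 1
  -- simplify the σ-expressions
  have eσ1 : 2 * (1 - 1 / L) - 1 = (L - 2) / L := by field_simp; ring
  have eσ2 : 2 * (1 - 1 / L) = (2 * L - 2) / L := by field_simp
  have eσ3 : 2 - 2 * (1 - 1 / L) = 2 / L := by field_simp; ring
  rw [eσ1, eσ3, eσ2]
  have hL2 : 0 < L - 2 := by linarith
  have hL22 : 0 < 2 * L - 2 := by linarith
  -- the three reciprocals
  have r1 : 1 / ((L - 2) / L) = L / (L - 2) := by rw [one_div_div]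
  have r2 : 1 / ((2 * L - 2) / L) = L / (2 * L - 2) := by rw [one_div_div]
  have r3 : 1 / (2 / L) = L / 2 := by rw [one_div_div]
  rw [r1, r2, r3]
  -- bounds: `L/(L−2) ≥ 1`, `L/(2L−2) ≤ 2/3`, `L/(L−2) ≤ 2`
  have b1 : 1 ≤ L / (L - 2) := by rw [le_div_iff₀ hL2]; linarith
  have b2 : L / (2 * L - 2) ≤ 2 / 3 := by rw [div_le_div_iff₀ hL22 (by norm_num)]; linarith
  have b3 : L / (L - 2) ≤ 2 := by rw [div_le_iff₀ hL2]; linarith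
  -- first bracket ≥ 2(y/e)(1/3); second ≤ 2e(L/2 + 2)
  have hye : 0 < y / e := div_pos hy0 he0
  have hA : 2 * (y / e) * (1 / 3) ≤ 2 * (y / e) * (L / (L - 2) - L / (2 * L - 2)) := by
    apply mul_le_mul_of_nonneg_left _ (by positivity); linarith
  have hB : 2 * e * (L / 2 + L / (L - 2)) ≤ 2 * e * (L / 2 + 2) := by
    apply mul_le_mul_of_nonneg_left _ (by positivity); linarith
  -- σ(1−σ) = (1 − 1/L)/L ∈ [3/(4L), 1/L]
  have hs : (1 - 1 / L) * (1 / L) ≤ 1 / L := by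
    have : 0 ≤ 1 / L := by positivity
    have : 1 - 1 / L ≤ 1 := by linarith
    nlinarith
  have hs' : 3 / (4 * L) ≤ (1 - 1 / L) * (1 / L) := by
    have hq : 3 / 4 ≤ 1 - 1 / L := by
      rw [le_sub_iff_add_le, show (3 : ℝ) / 4 + 1 / L = 3 / 4 + 1 / L from rfl]
      have : 1 / L ≤ 1 / 4 := one_div_le_one_div_of_le (by norm_num) hL4
      linarith
    have : 3 / (4 * L) = 3 / 4 * (1 / L) := by field_simp
    rw [this]
    exact mul_le_mul_of_nonneg_right hq (by positivity)
  -- assemble: the bracket is `X := A' − B' − 1` with `A' ≥ 2y/(3e)`, `B' ≤ eL + 4e`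
  set A' := 2 * (y / e) * (L / (L - 2) - L / (2 * L - 2)) with hA'
  set B' := 2 * e * (L / 2 + L / (L - 2)) with hB'
  set s := (1 - 1 / L) * (1 / L) with hsdef
  have hs0 : 0 ≤ s := by rw [hsdef]; exact le_trans (by positivity) hs'
  have hA'0 : 0 ≤ A' := le_trans (by positivity) hA
  -- `s·(A' − B' − 1) ≥ (3/(4L))·A' − (1/L)(B' + 1)` since `A' ≥ 0`, `B' + 1 ≥ 0`
  have hB'0 : 0 ≤ B' + 1 := by rw [hB']; positivity
  have hprod : 3 / (4 * L) * A' - 1 / L * (B' + 1) ≤ s * (A' - B' - 1) := by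
    have h1 : 3 / (4 * L) * A' ≤ s * A' := mul_le_mul_of_nonneg_right hs' hA'0
    have h2 : s * (B' + 1) ≤ 1 / L * (B' + 1) := mul_le_mul_of_nonneg_right hs hB'0
    nlinarith
  -- `(3/(4L))·A' ≥ (3/(4L))·2y/(3e) = y/(2eL)` and `(1/L)(B' + 1) ≤ (1/L)(eL + 4e + 1) = e + (4e+1)/L ≤ e + (4e+1)/4`
  have hT1 : y / (2 * e * L) ≤ 3 / (4 * L) * A' := by
    have : y / (2 * e * L) = 3 / (4 * L) * (2 * (y / e) * (1 / 3)) := by field_simp; ring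
    rw [this]
    exact mul_le_mul_of_nonneg_left hA (by positivity)
  have hT2 : 1 / L * (B' + 1) ≤ e + (4 * e + 1) / 4 := by
    have h1 : 1 / L * (B' + 1) ≤ 1 / L * (2 * e * (L / 2 + 2) + 1) :=
      mul_le_mul_of_nonneg_left (by linarith) (by positivity)
    have h2 : 1 / L * (2 * e * (L / 2 + 2) + 1) = e + (4 * e + 1) / L := by field_simp; ring
    have h3 : (4 * e + 1) / L ≤ (4 * e + 1) / 4 :=
      div_le_div_of_nonneg_left (by positivity) (by norm_num) hL4
    linarith
  have hnum : e + (4 * e + 1) / 4 ≤ 6 := by nlinarith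
  linarith

/-- **The Hecke point: `L(1 − 1/log(√d/2), χ) ≥ 0 ⇒ h_K ≥ √d/(4e·log(√d/2)) − 5`** (`√d/2 ≥ e⁴`, i.e.
`d ≥ 4e⁸ ≈ 11924`): Hecke's `√d/log d` class-number floor obtained from nonnegativity of `L(s, χ)` at the SINGLE
point `σ_d = 1 − 1/log(√d/2) ≈ 1 − 2/log d` (the tree's kernel Hecke lemma `Hecke.lOne_ge_eighth_of_noRealZero_near_one`
assumes no zero on the whole window `[1 − 1/(4 log q), 1]`). [cite: MontgomeryVaughan2007, §11.2 Theorem 11.4]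
[cite: IwaniecConversations2006, §5] -/
theorem classNumber_ge_of_LFunction_heckePoint_nonneg (h2 : finrank ℚ K = 2) {d : ℕ} [NeZero d]
    (hdK : NumberField.discr K = -(d : ℤ)) (hd : Real.exp 4 ≤ Real.sqrt d / 2) {χ : DirichletCharacter ℂ d}
    (hprim : χ.IsPrimitive) (hquad : χ.IsQuadratic) (hodd : χ.Odd)
    (hL : 0 ≤ (χ.LFunction ((1 - 1 / Real.log (Real.sqrt d / 2) : ℝ) : ℂ)).re) :
    Real.sqrt d / (4 * Real.exp 1 * Real.log (Real.sqrt d / 2)) - 5 ≤ (classNumber K : ℝ) := by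
  set y := Real.sqrt d / 2 with hydef
  have he4 : (49 : ℝ) < Real.exp 4 := by
    have he := Real.exp_one_gt_d9
    have h2 : (7 : ℝ) < Real.exp 2 := by
      rw [show (2 : ℝ) = 1 + 1 by norm_num, Real.exp_add]; nlinarith
    rw [show (4 : ℝ) = 2 + 2 by norm_num, Real.exp_add]; nlinarith [Real.exp_pos 2]
  have hy49 : 49 < y := lt_of_lt_of_le he4 hd
  have hy0 : 0 < y := by linarith
  have hsd : 98 < Real.sqrt d := by rw [hydef] at hy49; linarith
  have hd4 : 4 < d := by
    by_contra hcon
    push Not at hcon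
    have : Real.sqrt d ≤ Real.sqrt 4 := Real.sqrt_le_sqrt (by exact_mod_cast hcon)
    have h4 : Real.sqrt 4 = 2 := by
      rw [show (4 : ℝ) = 2 ^ 2 by norm_num, Real.sqrt_sq (by norm_num)]
    linarith
  set L := Real.log y with hLdef
  have hL4 : 4 ≤ L := by rw [hLdef, Real.le_log_iff_exp_le hy0]; exact hd
  have hσ : 1 / 2 < 1 - 1 / L := by
    have : 1 / L ≤ 1 / 4 := one_div_le_one_div_of_le (by norm_num) hL4
    linarith
  have hσ1 : 1 - 1 / L < 1 := by
    have : 0 < 1 / L := by positivity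
    linarith
  have hmain := classNumber_ge_of_LFunction_ofReal_nonneg h2 hdK hd4 hprim hquad hodd hσ hσ1 hL
  have hnum := heckePoint_bound hd
  rw [← hLdef] at hnum
  rw [← hydef] at hmain
  have e : Real.sqrt d / (4 * Real.exp 1 * L) = y / (2 * Real.exp 1 * L) := by
    rw [hydef]; field_simp; ring
  rw [e]
  linarith

/-- The Hecke point in `d`-currency: since `log(√d/2) < ½ log d`, **`L(1 − 1/log(√d/2), χ) ≥ 0 ⇒
h_K ≥ √d/(2e log d) − 5`** (`√d/2 ≥ e⁴`). [cite: MontgomeryVaughan2007, §11.2 Theorem 11.4]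
[cite: IwaniecConversations2006, §5] -/
theorem classNumber_ge_of_LFunction_heckePoint_nonneg' (h2 : finrank ℚ K = 2) {d : ℕ} [NeZero d]
    (hdK : NumberField.discr K = -(d : ℤ)) (hd : Real.exp 4 ≤ Real.sqrt d / 2) {χ : DirichletCharacter ℂ d}
    (hprim : χ.IsPrimitive) (hquad : χ.IsQuadratic) (hodd : χ.Odd)
    (hL : 0 ≤ (χ.LFunction ((1 - 1 / Real.log (Real.sqrt d / 2) : ℝ) : ℂ)).re) :
    Real.sqrt d / (2 * Real.exp 1 * Real.log d) - 5 ≤ (classNumber K : ℝ) := by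
  have h := classNumber_ge_of_LFunction_heckePoint_nonneg h2 hdK hd hprim hquad hodd hL
  have he4 : (1 : ℝ) < Real.exp 4 := by
    have := Real.add_one_le_exp (4 : ℝ); linarith
  have hy1 : 1 < Real.sqrt d / 2 := lt_of_lt_of_le he4 hd
  have hsd0 : 0 < Real.sqrt d := by linarith
  have hd0 : (0 : ℝ) < d := by
    by_contra hcon
    push Not at hcon
    have : Real.sqrt d = 0 := Real.sqrt_eq_zero'.2 hcon
    linarith
  have hlogy : 0 < Real.log (Real.sqrt d / 2) := Real.log_pos hy1
  have hlog : Real.log (Real.sqrt d / 2) ≤ Real.log d / 2 := by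
    rw [Real.log_div hsd0.ne' two_ne_zero, Real.log_sqrt hd0.le]
    have := Real.log_two_gt_d9
    linarith
  have hlogd : 0 < Real.log d := by linarith
  have he0 : 0 < Real.exp 1 := Real.exp_pos 1
  have hstep : Real.sqrt d / (2 * Real.exp 1 * Real.log d) ≤
      Real.sqrt d / (4 * Real.exp 1 * Real.log (Real.sqrt d / 2)) := by
    apply div_le_div_of_nonneg_left hsd0.le (by positivity)
    nlinarith
  linarith

/-! ### Direction I: a small class number forces a real zero in `(σ, 1)` -/

/-- **Small class number ⇒ a real zero in `(σ, 1)`.** If, for some `σ ∈ (½, 1)`,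
`h_K < 1 + σ(1−σ)[2y^σ(1/(2σ−1) − 1/(2σ)) − 2y^{1−σ}(1/(2−2σ) + 1/(2σ−1)) − 1]` (`y = √d/2`), then `L(σ, χ) < 0`,
and since `L(1, χ) > 0` the real-valued `L(s, χ)` vanishes at some `β ∈ (σ, 1)` (intermediate value theorem,
tree `DirichletAbel.LFunction_ofReal_re_pos_of_forall_ne_zero`). [cite: IwaniecConversations2006, §4 (4.23)–(4.25) and §5] -/
theorem exists_realZero_of_classNumber_lt (h2 : finrank ℚ K = 2) {d : ℕ} [NeZero d]
    (hdK : NumberField.discr K = -(d : ℤ)) (hd : 4 < d) {χ : DirichletCharacter ℂ d}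
    (hprim : χ.IsPrimitive) (hquad : χ.IsQuadratic) (hodd : χ.Odd) {σ : ℝ} (hσ : 1 / 2 < σ) (hσ1 : σ < 1)
    (hh : (classNumber K : ℝ) < 1 + σ * (1 - σ) * (2 * (Real.sqrt d / 2) ^ σ * (1 / (2 * σ - 1) - 1 / (2 * σ)) -
        2 * (Real.sqrt d / 2) ^ (1 - σ) * (1 / (2 - 2 * σ) + 1 / (2 * σ - 1)) - 1)) :
    (χ.LFunction σ).re < 0 ∧ ∃ β : ℝ, σ < β ∧ β < 1 ∧ χ.LFunction β = 0 := by
  have hχ1 : χ ≠ 1 := by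
    intro h
    have h1 : χ (-1) = -1 := hodd
    rw [h, MulChar.one_apply (isUnit_one.neg)] at h1
    norm_num at h1
  have hσ0 : (0 : ℝ) < σ := by linarith
  have hneg : (χ.LFunction σ).re < 0 := by
    by_contra hcon
    push Not at hcon
    have := classNumber_ge_of_LFunction_ofReal_nonneg h2 hdK hd hprim hquad hodd hσ hσ1 hcon
    linarith
  refine ⟨hneg, ?_⟩
  by_contra hcon
  push Not at hcon
  have hz : ∀ σ' : ℝ, σ ≤ σ' → σ' ≤ 1 → χ.LFunction σ' ≠ 0 := by
    intro σ' h1 h2 h0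
    rcases eq_or_lt_of_le h1 with h | h
    · rw [← h] at h0
      rw [h0, Complex.zero_re] at hneg
      exact lt_irrefl _ hneg
    rcases eq_or_lt_of_le h2 with h' | h'
    · rw [h'] at h0
      exact χ.LFunction_apply_one_ne_zero hχ1 (by exact_mod_cast h0)
    · exact hcon σ' h h' h0
  have hpos := DirichletAbel.LFunction_ofReal_re_pos_of_forall_ne_zero χ hχ1 hquad.sq_eq_one hσ0 hσ1.le hz
  linarith

/-- **`h_K < 13/16 + ½(√d/2)^{3/4} − (3/2)(√d/2)^{1/4}` ⇒ `L(s, χ)` has a real zero in `(¾, 1)`.**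
[cite: IwaniecConversations2006, §4 (4.23)–(4.25) and §5] -/
theorem exists_realZero_gt_threeQuarters_of_classNumber_lt (h2 : finrank ℚ K = 2) {d : ℕ} [NeZero d]
    (hdK : NumberField.discr K = -(d : ℤ)) (hd : 4 < d) {χ : DirichletCharacter ℂ d}
    (hprim : χ.IsPrimitive) (hquad : χ.IsQuadratic) (hodd : χ.Odd)
    (hh : (classNumber K : ℝ) < 13 / 16 + (Real.sqrt d / 2) ^ (3 / 4 : ℝ) / 2 - 3 / 2 * (Real.sqrt d / 2) ^ (1 / 4 : ℝ)) :
    ∃ β : ℝ, 3 / 4 < β ∧ β < 1 ∧ χ.LFunction β = 0 := by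
  refine (exists_realZero_of_classNumber_lt h2 hdK hd hprim hquad hodd (σ := 3 / 4) (by norm_num)
    (by norm_num) ?_).2
  have e1 : (1 : ℝ) - 3 / 4 = 1 / 4 := by norm_num
  rw [e1]
  norm_num at hh ⊢
  linarith

/-- **`h_K < √d/(4e log(√d/2)) − 5` (`√d/2 ≥ e⁴`) ⇒ `L(s, χ)` has a real zero `β` with
`1 − 1/log(√d/2) < β < 1`** — the exceptional zero of a class-number-deficient imaginary quadratic field,
located within `≈ 2/log d` of `s = 1` (compare the tree's `RealZeroRepulsion.exists_realZero_of_lOne_lt`: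
`L(1,χ) < 1/(8 log q)`, i.e. `h_K < √q/(8π log q)`, ⇒ zero in `[1 − 1/(4 log q), 1)`).
[cite: MontgomeryVaughan2007, §11.2 Theorem 11.4] [cite: IwaniecConversations2006, §5] -/
theorem exists_realZero_near_one_of_classNumber_lt (h2 : finrank ℚ K = 2) {d : ℕ} [NeZero d]
    (hdK : NumberField.discr K = -(d : ℤ)) (hd : Real.exp 4 ≤ Real.sqrt d / 2) {χ : DirichletCharacter ℂ d}
    (hprim : χ.IsPrimitive) (hquad : χ.IsQuadratic) (hodd : χ.Odd)
    (hh : (classNumber K : ℝ) < Real.sqrt d / (4 * Real.exp 1 * Real.log (Real.sqrt d / 2)) - 5) :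
    ∃ β : ℝ, 1 - 1 / Real.log (Real.sqrt d / 2) < β ∧ β < 1 ∧ χ.LFunction β = 0 := by
  set y := Real.sqrt d / 2 with hydef
  have he4 : (49 : ℝ) < Real.exp 4 := by
    have he := Real.exp_one_gt_d9
    have h2' : (7 : ℝ) < Real.exp 2 := by
      rw [show (2 : ℝ) = 1 + 1 by norm_num, Real.exp_add]; nlinarith
    rw [show (4 : ℝ) = 2 + 2 by norm_num, Real.exp_add]; nlinarith [Real.exp_pos 2]
  have hy49 : 49 < y := lt_of_lt_of_le he4 hd
  have hy0 : 0 < y := by linarith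
  have hd4 : 4 < d := by
    by_contra hcon
    push Not at hcon
    have : Real.sqrt d ≤ Real.sqrt 4 := Real.sqrt_le_sqrt (by exact_mod_cast hcon)
    have h4 : Real.sqrt 4 = 2 := by
      rw [show (4 : ℝ) = 2 ^ 2 by norm_num, Real.sqrt_sq (by norm_num)]
    rw [hydef] at hy49
    linarith
  set L := Real.log y with hLdef
  have hL4 : 4 ≤ L := by rw [hLdef, Real.le_log_iff_exp_le hy0]; exact hd
  have hσ : 1 / 2 < 1 - 1 / L := by
    have : 1 / L ≤ 1 / 4 := one_div_le_one_div_of_le (by norm_num) hL4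
    linarith
  have hσ1 : 1 - 1 / L < 1 := by
    have : 0 < 1 / L := by positivity
    linarith
  refine (exists_realZero_of_classNumber_lt h2 hdK hd4 hprim hquad hodd hσ hσ1 ?_).2
  have hnum := heckePoint_bound hd
  rw [← hLdef] at hnum
  rw [← hydef]
  have e : Real.sqrt d / (4 * Real.exp 1 * L) = y / (2 * Real.exp 1 * L) := by
    rw [hydef]; field_simp; ring
  rw [e] at hh
  linarith

end RealPointExit

end Literature.NumberTheory.LFunctions

end
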